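import Summits.NavierStokesRegularity.FluidComputer.GateBudgetLadderStepPair
import Summits.NavierStokesRegularity.FluidComputer.GateBudgetCleanHorizon
import Summits.NavierStokesRegularity.FluidComputer.GateBudgetDudHorizonPair
import HarnessLib

/-!
# GateBudget part 121 — the clean dud horizon of EVERY lattice member, two-sided (§319–§321)

Cell `pub-fluidc`, blueprint seat bp1 (gen 41, SPEC-INPUT-bp1 §CO(4)(b): "general k — the
paper's stated generality"); namespace `Summit.NavierStokesRegularity.FluidComputer.GateBudget`,
headline member `RotorKnob.rotorCircuit K K¹⁰ ε ρ` of the two-scale family from `delayInit`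
(5.6), `K ≥ 16`, `ε² ≤ 1/(6K²⁰)`, on the lattice window `200ε/K²⁰ ≤ ρ² ≤ 2ε/K¹⁰`, `ε = kK¹⁰ρ²`,
winding number `1 ≤ k ≤ K²` (floor) / any `k` (ceiling); modes `0 = a` (carrier), `1 = b`
(clock), `2 = c` (trigger), `3 = d` (transfer), `4 = ã` (output). HONEST FRAMING: a low prior,
high value-of-information experiment on Tao's machine paradigm; NOT a claim that NS blows up.

WHY. Parts 118/119 state the clean dud horizon — the length `cleanHorizon K ε ρ X Θ` (part 118
§313) of the longest pulse-separated run of clean normal-form ignitions of the trajectory — as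
ONE two-sided theorem, but only on the unit lattice `k = 1`, where the swing law prices a rung
at `U = 2`. The family's general member has an arbitrary winding number `k`, and both halves
of its horizon were already in the tree in the OLD currencies: part 98 §273 (the √P pair ladder
from `delayInit`, rung price `U = 7/2 + k²/3 + 10⁻³`, `k ≤ K²`, rungs handed out one index at a
time) and part 72 §219 (ANY pulse-separated clean run has `N ≤ K⁹/7 + 1`, every `k`). With
part 120's step lemma the first becomes a RUN, and both read through part 118's definitions.
WHAT. §319 `knob_ladder_run_pair` — part 97's ladder as SEQUENCES `r θ : ℕ → ℝ` with
`SwingRung … (n + 1) (r n) (θ n)` for `n + 1 ≤ N` and `r (n + 1) ≥ r n + 1` (part 118 §311's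
dependent choice over part 120 §318's step). §320 `knob_clean_run_pair` — THE MEMBER'S CLEAN
RUN, every `k ≤ K²`: for `1 ≤ N` in part 98's √-window `(N - 1)(7/2 + k²/3 + 10⁻³)/K⁹ + (14k +
127) log N/(5K⁴) ≤ 0.1409` there is ONE run of `N` normal-form ignitions `rₙ > 1.8282 + (n +
1)`, `r_{n+1} ≥ rₙ + 1`, `5/4 ≤ θₙ ≤ 29/20`, `c = ρ²/K⁹`, `P ≤ 1/50`, `n/K⁹ ≤ ã ≤ 0.1415`, `|d| ≤
7/K⁴` (part 98's rungs, in one climb). §321 `clean_run_length_le_winding` — part 72 §219 read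
through `IsCleanRun`: every clean run with clock ceiling `Θ ≤ 3/2` has `N ≤ K⁹/7 + 1`, every
`k`. §321 `knob_clean_horizon_winding` — TWO-SIDED, every `k ≤ K²`: every `N` in the √-window
has `N ≤ cleanHorizon K ε ρ X (29/20)`, and `cleanHorizon K ε ρ X Θ ≤ K⁹/7 + 1` for every `Θ ≤
3/2`. §321 `knob_clean_horizon_winding_explicit` — for `k ≤ K` the window is solved in closed
form: `K⁹/(10·(7/2 + k²/3 + 10⁻³)) ≤ cleanHorizon K ε ρ X (29/20)` (the log term costs `≤
0.0269 ≤ 0.0409` since `log K ≤ (log 16/16)K`, `14k + 127 ≤ 22K`, `K² ≥ 256`): the clean dud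
horizon of EVERY member `k ≤ K` is of exact order `K⁹`, within a factor `5.01 + 0.48k²` (plus
one); part 122 is the hypothesis-minimal read-out (part 119's shape, `ε := kK¹⁰ρ²` from `ρ`).
HOW. §319/§320 are part 118 §311/§312 line by line with part 97/98/120 in place of parts
107/108/117 (part 98's window plumbing verbatim: anchor part 86 §241, ledgers part 83 §242,
part 96 §271 `pair_window_coarse_sqrt`, parts 85/89); §321 is part 118 §314's `sSup` argument
(`Nat.sSup_mem`, `le_csSup`, the empty run) with the bound `⌊K⁹/7 + 1⌋₊` and its log numerics.
HONEST LIMITS. (i) the floor's rung price is part 90's crude `U ≈ 3.83 + k²/3` — at `k = 1`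
the window here is `[0.026, 0.143]K⁹`, part 118/119's swing window `[0.065, 0.1132]K⁹` is the
sharper statement, and no swing price exists for `k ≥ 2` (SPEC-INPUT-bp1 §BV(4): the gain
needs the phase pinning `Φ₁ ≈ 0.25` of `k = 1`); (ii) `k ≤ K²` (window form) / `k ≤ K` (closed
form) come from part 83's d-ledger and the uniform log budget, not from the dynamics — larger
`k` is not claimed either way; (iii) existence of one long clean run and a bound on all of
them; which run the machine actually performs after the horizon is not described; (iv) nothing
about Navier–Stokes: these are inequalities about Tao's five-mode toy circuit (5.5)/(5.6).
[cite: Tao2016AveragedNS, §5.5 Theorem 5.3, (5.5), (5.6), (b-eq), (c-eq), (d-eq), (ta-eq),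
(energy-con), (est)]
-/

noncomputable section

namespace Summit.NavierStokesRegularity.FluidComputer.GateBudget

open Real Set Filter Topology
open Literature.Analysis.FluidPDE.Tao2016AveragedNS

variable {K ε ρ : ℝ} {X : ℝ → Fin 5 → ℝ} {C : ℝ → ℝ}

/-! ## §319 The pair ladder as a run -/

/-- §319 **THE PAIR LADDER AS A RUN, EVERY WINDING NUMBER k** (part 97 §272's hypotheses
VERBATIM, and `1 ≤ N`): there are SEQUENCES `r θ : ℕ → ℝ` with `SwingRung … (n + 1) (r n) (θ n)`
for every `n + 1 ≤ N` and `r (n + 1) ≥ r n + 1` for every `n` — the first rung is part 97's (`n =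
1`, §317), each next one is part 120 §318's step from the previous one (dependent choice, part
118 §311 `run_of_step`); past the window the sequence is continued by `r + 1` (no claim there).
[derived: part 120 §317–§318, part 118 §311] -/
theorem knob_ladder_run_pair
    (hX : ∀ t, HasDerivAt X (RotorKnob.rotorCircuit K (K ^ 10) ε ρ (X t)) t)
    (h0 : X 0 = delayInit) (hC : ∀ t, HasDerivAt C (X t 2) t) (hK : 16 ≤ K)
    (hε : 0 < ε) (hεK : ε ^ 2 ≤ 1 / (6 * K ^ 20)) (hρ : 0 < ρ)
    (hlo : 200 * ε / K ^ 20 ≤ ρ ^ 2) (hhi : K ^ 10 * ρ ^ 2 ≤ 2 * ε) (k : ℕ)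
    (hk : ε = k * K ^ 10 * ρ ^ 2) {r₀ θ₀ P₁ A₀ D₀ D U δ L : ℝ} {N : ℕ} (hr₀ : 0 ≤ r₀)
    (hb₀ : X r₀ 1 = θ₀ * ε) (hc₀ : X r₀ 2 = ρ ^ 2 / K ^ 9) (hP₁ : X r₀ 3 ^ 2 + X r₀ 4 ^ 2 ≤ P₁)
    (hθ₀lo : 139 / 100 - L ≤ θ₀) (hθ₀hi : θ₀ ≤ 29 / 20)
    (hL42 : L ≤ 42 / K ^ 9) (hN9 : (N : ℝ) - 1 ≤ K ^ 9)
    (hA0 : 0 ≤ A₀) (hA₀ : A₀ ≤ X r₀ 4) (hD₀ : |X r₀ 3| ≤ D₀)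
    (hD : D₀ + (1 + 10 / 9 * K ^ 4) * ((61 / 12 * k + 2 / 3) / K ^ 10 + 3 / K ^ 9) ≤ D)
    (hU : 7 / 2 + k ^ 2 / 3 + (2 * log k + 520 * log K) * D ^ 2 ≤ U)
    (hδ : (2 * D + (2 * k + 3) / (5 * K ^ 9)) * ((2 * k + 3) / (5 * K ^ 9))
      + 6 * (D + (2 * k + 3) / (5 * K ^ 9) + 3 / K ^ 9) / K ^ 9 ≤ δ)
    (hL : 242 * log K / K ^ 10 + 37 * (D + (2 * k + 3) / (5 * K ^ 9) + 4 / K ^ 9) / K ^ 9 ≤ L)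
    (hNW : (√P₁ + ((N : ℝ) - 1) * (U / K ^ 9) + δ * K ^ 9 / 2 * log N) ^ 2
      + (3 * (k * π / ((25 / 16 - 1 / 10 ^ 6) * K ^ 10 - 1) + 1 / K ^ 19
      + 310 * log K / K ^ 9) / 10 + 6 / K ^ 9) + δ ≤ 1 / 50)
    (hNpos : 1 ≤ N) :
    ∃ r θ : ℕ → ℝ,
      (∀ n : ℕ, n + 1 ≤ N → SwingRung K ε ρ X k r₀ P₁ A₀ D₀ U δ L (n + 1) (r n) (θ n)) ∧
      ∀ n : ℕ, r n + 1 ≤ r (n + 1) := by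
  obtain ⟨r₁, θ₁, h1⟩ := knob_ladder_pair_rung hX h0 hC hK hε hεK hρ hlo hhi k hk hr₀ hb₀ hc₀ hP₁
    hθ₀lo hθ₀hi hL42 hN9 hA0 hA₀ hD₀ hD hU hδ hL hNW 1 le_rfl hNpos
  have hstep : ∀ (n : ℕ) (p : ℝ × ℝ),
      (n + 1 ≤ N → SwingRung K ε ρ X k r₀ P₁ A₀ D₀ U δ L (n + 1) p.1 p.2) → ∃ q : ℝ × ℝ,
        (n + 1 + 1 ≤ N → SwingRung K ε ρ X k r₀ P₁ A₀ D₀ U δ L (n + 1 + 1) q.1 q.2) ∧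
          p.1 + 1 ≤ q.1 := by
    intro n p hp
    by_cases h : n + 2 ≤ N
    · obtain ⟨r', θ', hsep, hrung⟩ := knob_ladder_step_pair hX h0 hC hK hε hεK hρ hlo hhi k hk
        hr₀ hP₁ hL42 hN9 hA0 hD₀ hD hU hδ hL hNW (m := n + 1) (by omega) (by omega) (hp (by omega))
      exact ⟨(r', θ'), fun _ => hrung, hsep⟩
    · exact ⟨(p.1 + 1, p.2), fun h' => absurd h' (by omega), le_rfl⟩
  obtain ⟨f, hf, hR⟩ := run_of_step
    (P := fun (n : ℕ) (p : ℝ × ℝ) =>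
      n + 1 ≤ N → SwingRung K ε ρ X k r₀ P₁ A₀ D₀ U δ L (n + 1) p.1 p.2)
    (R := fun p q : ℝ × ℝ => p.1 + 1 ≤ q.1) (a := (r₁, θ₁)) (fun _ => h1) hstep
  exact ⟨fun n => (f n).1, fun n => (f n).2, fun n hn => hf n hn, fun n => hR n⟩

/-! ## §320 The member's clean run, every winding number k ≤ K² -/

/-- §320 **THE CLEAN RUN OF THE LATTICE MEMBER, EVERY k ≤ K²** (from `delayInit` with a trigger
primitive `C`, `K ≥ 16`, `0 < ε`, `ε² ≤ 1/(6K²⁰)`, `0 < ρ`, `200ε/K²⁰ ≤ ρ²`, `K¹⁰ρ² ≤ 2ε`, `ε =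
kK¹⁰ρ²`, `k ≤ K²`; `1 ≤ N` in part 98 §273's √-window `(N - 1)(7/2 + k²/3 + 10⁻³)/K⁹ + (14k +
127) log N/(5K⁴) ≤ 0.1409`): there is ONE run `(rₙ, θₙ)_{n<N}` of normal-form ignitions — `rₙ >
1.8282 + (n + 1)`, `r_{n+1} ≥ rₙ + 1`, `b(rₙ) = θₙε` with `5/4 ≤ θₙ ≤ 29/20`, `c(rₙ) = ρ²/K⁹`,
`√P(rₙ) ≤ 7/K⁴ + n(7/2 + k²/3 + 10⁻³)/K⁹ + (14k + 127) log(n + 1)/(5K⁴)`, `P(rₙ) ≤ 1/50`, `n/K⁹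
≤ ã(rₙ) ≤ 0.1415`, `|d(rₙ)| ≤ 7/K⁴` — part 98 §273's rungs, in one climb. [derived: this file
§319, part 98 §273 (plumbing verbatim), part 86 §241, part 83 §242, part 96 §271, part 85 §250,
part 89 §258, part 118 §311 (`swingRung_readout`)] -/
theorem knob_clean_run_pair
    (hX : ∀ t, HasDerivAt X (RotorKnob.rotorCircuit K (K ^ 10) ε ρ (X t)) t)
    (h0 : X 0 = delayInit) (hC : ∀ t, HasDerivAt C (X t 2) t) (hK : 16 ≤ K)
    (hε : 0 < ε) (hεK : ε ^ 2 ≤ 1 / (6 * K ^ 20)) (hρ : 0 < ρ)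
    (hlo : 200 * ε / K ^ 20 ≤ ρ ^ 2) (hhi : K ^ 10 * ρ ^ 2 ≤ 2 * ε) (k : ℕ)
    (hk : ε = k * K ^ 10 * ρ ^ 2) (hkK : (k : ℝ) ≤ K ^ 2) (N : ℕ) (hNpos : 1 ≤ N)
    (hNW : ((N : ℝ) - 1) * ((7 / 2 + k ^ 2 / 3 + 1 / 1000) / K ^ 9)
      + (14 * k + 127) / (5 * K ^ 4) * log N ≤ 1409 / 10000) :
    ∃ r θ : ℕ → ℝ, (∀ n : ℕ, r n + 1 ≤ r (n + 1)) ∧ ∀ n : ℕ, n + 1 ≤ N →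
      18282 / 10000 + ((n : ℝ) + 1) < r n ∧ X (r n) 1 = θ n * ε ∧
      5 / 4 ≤ θ n ∧ θ n ≤ 29 / 20 ∧ X (r n) 2 = ρ ^ 2 / K ^ 9 ∧
      √(X (r n) 3 ^ 2 + X (r n) 4 ^ 2)
        ≤ 7 / K ^ 4 + (n : ℝ) * ((7 / 2 + k ^ 2 / 3 + 1 / 1000) / K ^ 9)
          + (14 * k + 127) / (5 * K ^ 4) * log ((n : ℝ) + 1) ∧
      X (r n) 3 ^ 2 + X (r n) 4 ^ 2 ≤ 1 / 50 ∧
      (n : ℝ) / K ^ 9 ≤ X (r n) 4 ∧ X (r n) 4 ≤ 1415 / 10000 ∧ |X (r n) 3| ≤ 7 / K ^ 4 := by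
  obtain ⟨r₁, θ₁, hr1, hb1, hθlo, hθhi, hc1, he0, hP1, hd1, hk1⟩ :=
    knob_ladder_anchor_member hX h0 hC hK hε hεK hρ hlo hhi k hk
  obtain ⟨hD, hU, -, -, hres⟩ := two_sided_numerics hK hk1 hkK
  have hS := clock_slip_numerics hK hk1 hkK
  obtain ⟨hL0, hL42⟩ := sharp_loss_numerics hK hk1 hkK
  obtain ⟨hcL, hwin⟩ := pair_ledger_numerics hK hk1 hkK
  have hK0 : (0 : ℝ) < K := by linarith
  have hK4 : (0 : ℝ) < K ^ 4 := by positivity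
  have hK9 : (0 : ℝ) < K ^ 9 := by positivity
  have hk0 : (0 : ℝ) ≤ k := Nat.cast_nonneg k
  obtain ⟨e₁, he₁_def⟩ : ∃ e₁ : ℝ,
      e₁ = k * π / (49 / 100 * K ^ 10 - 1) + 2 / K ^ 10 + 245 / K ^ 8 := ⟨_, rfl⟩
  obtain ⟨δ₀, hδ₀_def⟩ : ∃ δ₀ : ℝ,
      δ₀ = (2 * (7 / K ^ 4) + (2 * k + 3) / (5 * K ^ 9)) * ((2 * k + 3) / (5 * K ^ 9))
        + 6 * (7 / K ^ 4 + (2 * k + 3) / (5 * K ^ 9) + 3 / K ^ 9) / K ^ 9 := ⟨_, rfl⟩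
  obtain ⟨u, hu_def⟩ : ∃ u : ℝ, u = (7 / 2 + k ^ 2 / 3 + 1 / 1000) / K ^ 9 := ⟨_, rfl⟩
  obtain ⟨cM, hcM_def⟩ : ∃ cM : ℝ, cM = (14 * k + 127) / (5 * K ^ 4) := ⟨_, rfl⟩
  rw [← he₁_def] at hP1 hd1 hD hres
  rw [← hδ₀_def] at hcL
  have he₁0 : 0 ≤ e₁ := (abs_nonneg _).trans hd1
  have hsq₁ : √(e₁ ^ 2) = e₁ := Real.sqrt_sq he₁0
  have he₁7 : e₁ ≤ 7 / K ^ 4 := by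
    have hJ : 0 ≤ (1 + 10 / 9 * K ^ 4) * ((61 / 12 * k + 2 / 3) / K ^ 10 + 3 / K ^ 9) := by
      positivity
    linarith only [hD, hJ]
  have hu0 : 0 ≤ u := by rw [hu_def]; positivity
  have hδ₀0 : 0 ≤ δ₀ := by rw [hδ₀_def]; positivity
  have hδS : δ₀ ≤ (11 / 10 + k ^ 2 / 10) / K ^ 9 := by
    have h0 : 0 ≤ (2829 / 10000 + (7 / 2 + k ^ 2 / 3 + 1 / 1000) / K ^ 9)
        * ((7 / 2 + k ^ 2 / 3 + 1 / 1000) / K ^ 9) := by positivity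
    rw [hδ₀_def]; linarith only [hS, h0]
  have hcM0 : 0 ≤ cM := by rw [hcM_def]; positivity
  have hθ₀lo : 139 / 100 - (242 * log K / K ^ 10
        + 37 * (7 / K ^ 4 + (2 * k + 3) / (5 * K ^ 9) + 4 / K ^ 9) / K ^ 9) ≤ θ₁ := by
    linarith only [hL0, hθlo]
  simp only [← hu_def, ← hcM_def] at hNW hcL ⊢
  have hN1 : (1 : ℝ) ≤ N := by exact_mod_cast hNpos
  have hlogN : 0 ≤ log (N : ℝ) := Real.log_nonneg hN1
  have hcMN : 0 ≤ cM * log N := mul_nonneg hcM0 hlogN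
  -- `N - 1 ≤ K⁹` from the √-window (part 96 §271)
  have hN9 : (N : ℝ) - 1 ≤ K ^ 9 := by
    refine pair_window_coarse_sqrt hK (k := (k : ℝ)) ?_
    rw [← hu_def]; linarith only [hNW, hcMN]
  -- the √-window of part 97 §272 from the closed-form one (part 96 §271)
  have hcLN : δ₀ * K ^ 9 / 2 * log N ≤ cM * log N := mul_le_mul_of_nonneg_right hcL hlogN
  have hW0 : 0 ≤ √(e₁ ^ 2) + ((N : ℝ) - 1) * u + δ₀ * K ^ 9 / 2 * log N := by
    rw [hsq₁]
    have h1 : 0 ≤ ((N : ℝ) - 1) * u := mul_nonneg (by linarith only [hN1]) hu0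
    have h2 : 0 ≤ δ₀ * K ^ 9 / 2 * log N := mul_nonneg (by positivity) hlogN
    linarith only [he₁0, h1, h2]
  have hWle : √(e₁ ^ 2) + ((N : ℝ) - 1) * u + δ₀ * K ^ 9 / 2 * log N
      ≤ 7 / K ^ 4 + 1409 / 10000 := by
    rw [hsq₁]; linarith only [he₁7, hNW, hcLN]
  have hW2 := pow_le_pow_left₀ hW0 hWle 2
  have hNW' : (√(e₁ ^ 2) + ((N : ℝ) - 1) * u + δ₀ * K ^ 9 / 2 * log N) ^ 2
      + (3 * (k * π / ((25 / 16 - 1 / 10 ^ 6) * K ^ 10 - 1) + 1 / K ^ 19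
        + 310 * log K / K ^ 9) / 10 + 6 / K ^ 9) + δ₀ ≤ 1 / 50 := by
    nlinarith only [hW2, hres, sq_nonneg e₁, hδS, hwin]
  obtain ⟨r, θ, hrun, hsep⟩ := knob_ladder_run_pair hX h0 hC hK hε hεK hρ hlo hhi k hk
    (le_of_lt (by linarith only [hr1])) hb1 hc1 hP1 hθ₀lo (by linarith only [hθhi]) hL42 hN9
    le_rfl he0 hd1 hD hU (le_of_eq hδ₀_def.symm) le_rfl (by rw [← hu_def]; exact hNW') hNpos
  refine ⟨r, θ, hsep, fun n hn => ?_⟩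
  have hR := hrun n hn
  obtain ⟨hP, -, ha, hd⟩ := swingRung_readout (X := X) hK hε hρ hlo k hk le_rfl hD (by omega) hR
  unfold SwingRung at hR
  have en : ((n + 1 : ℕ) : ℝ) = n + 1 := Nat.cast_succ n
  have en1 : (n : ℝ) + 1 - 1 = n := by ring
  rw [en, en1] at hR
  obtain ⟨hr, hb, hθ1, hθ2, hc, hW, -, hA, -, -, -⟩ := hR
  have hn0 : (0 : ℝ) ≤ n := Nat.cast_nonneg n
  have hlogn : 0 ≤ log ((n : ℝ) + 1) := Real.log_nonneg (by linarith only [hn0])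
  have hcLn : δ₀ * K ^ 9 / 2 * log ((n : ℝ) + 1) ≤ cM * log ((n : ℝ) + 1) :=
    mul_le_mul_of_nonneg_right hcL hlogn
  refine ⟨by linarith only [hr, hr1], hb, hθ1, hθ2, hc, ?_, hP, by simpa using hA, ha, hd⟩
  rw [hsq₁, ← hu_def] at hW
  linarith only [hW, he₁7, hcLn]

/-! ## §321 The clean dud horizon of every lattice member, two-sided -/

/-- §321 THE CEILING FOR CLEAN RUNS, EVERY LATTICE MEMBER = part 72 §219 read through part 118
§313's definition: for the member (`K ≥ 16`, `ε² ≤ 1/(6K²⁰)`, the lattice window, `ε = kK¹⁰ρ²`,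
ANY `k`) every clean run with clock ceiling `Θ ≤ 3/2` has `N ≤ K⁹/7 + 1` (each rung leaks `≥
1/K⁹` of output, which starts `≥ 0` and is `≤ 1/7` at the last clean ignition). [derived: part 72
§219, part 118 §313] -/
theorem clean_run_length_le_winding
    (hX : ∀ t, HasDerivAt X (RotorKnob.rotorCircuit K (K ^ 10) ε ρ (X t)) t)
    (h0 : X 0 = delayInit) (hC : ∀ t, HasDerivAt C (X t 2) t) (hK : 16 ≤ K) (hε : 0 < ε)
    (hεK : ε ^ 2 ≤ 1 / (6 * K ^ 20)) (hρ : 0 < ρ) (hlo : 200 * ε / K ^ 20 ≤ ρ ^ 2)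
    (hhi : K ^ 10 * ρ ^ 2 ≤ 2 * ε) (k : ℕ) (hk : ε = k * K ^ 10 * ρ ^ 2) {Θ : ℝ}
    (hΘ : Θ ≤ 3 / 2) {N : ℕ} {r θ : ℕ → ℝ} (h : IsCleanRun K ε ρ X Θ N r θ) :
    (N : ℝ) ≤ K ^ 9 / 7 + 1 := by
  obtain ⟨hr0, hsep, hall⟩ := h
  exact knob_dud_ceiling hX h0 hC hK hε hεK hρ hlo hhi k hk hr0 hsep
    (fun n hn => ⟨(hall n hn).1.1, (hall n hn).1.2.trans hΘ⟩) (fun n hn => (hall n hn).2.1)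
    (fun n hn => (hall n hn).2.2.1) (fun n hn => (hall n hn).2.2.2)

/-- §321 **THE CLEAN DUD HORIZON OF EVERY LATTICE MEMBER, TWO-SIDED** (headline member
`rotorCircuit K K¹⁰ ε ρ` from `delayInit` with a trigger primitive `C`, `K ≥ 16`, `0 < ε`, `ε² ≤
1/(6K²⁰)`, `0 < ρ`, `200ε/K²⁰ ≤ ρ²`, `K¹⁰ρ² ≤ 2ε`, `ε = kK¹⁰ρ²`, winding number `k ≤ K²`): every
`N` in part 98's √-window `(N - 1)(7/2 + k²/3 + 10⁻³)/K⁹ + (14k + 127) log N/(5K⁴) ≤ 0.1409`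
satisfies `N ≤ cleanHorizon K ε ρ X (29/20)` (the member's own ladder, §320, is a clean run of
that length: its rungs are a whole time unit `≥ 242/K⁹` apart), and `cleanHorizon K ε ρ X Θ ≤
K⁹/7 + 1` for every clock ceiling `Θ ≤ 3/2` (§321, on a longest clean run, `Nat.sSup_mem`). At
`k = 1` part 118 §314's swing window `[0.065K⁹, 0.1132K⁹ + 1]` is sharper on both sides; for
`k ≥ 2` this is the only two-sided statement. [derived: this file §320–§321, part 72 §219, part
118 §313; `Nat.sSup_mem`, `le_csSup`] -/
theorem knob_clean_horizon_winding
    (hX : ∀ t, HasDerivAt X (RotorKnob.rotorCircuit K (K ^ 10) ε ρ (X t)) t)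
    (h0 : X 0 = delayInit) (hC : ∀ t, HasDerivAt C (X t 2) t) (hK : 16 ≤ K) (hε : 0 < ε)
    (hεK : ε ^ 2 ≤ 1 / (6 * K ^ 20)) (hρ : 0 < ρ) (hlo : 200 * ε / K ^ 20 ≤ ρ ^ 2)
    (hhi : K ^ 10 * ρ ^ 2 ≤ 2 * ε) (k : ℕ) (hk : ε = k * K ^ 10 * ρ ^ 2) (hkK : (k : ℝ) ≤ K ^ 2) :
    (∀ N : ℕ, ((N : ℝ) - 1) * ((7 / 2 + k ^ 2 / 3 + 1 / 1000) / K ^ 9)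
        + (14 * k + 127) / (5 * K ^ 4) * log N ≤ 1409 / 10000 →
        N ≤ cleanHorizon K ε ρ X (29 / 20)) ∧
      ∀ Θ : ℝ, Θ ≤ 3 / 2 → (cleanHorizon K ε ρ X Θ : ℝ) ≤ K ^ 9 / 7 + 1 := by
  have hK0 : (0 : ℝ) < K := by linarith
  have hK9 : (0 : ℝ) < K ^ 9 := by positivity
  -- the lengths of clean runs: a nonempty set of naturals, bounded by part 72 §219
  have hbdd : ∀ Θ : ℝ, Θ ≤ 3 / 2 →
      BddAbove {N : ℕ | ∃ r θ : ℕ → ℝ, IsCleanRun K ε ρ X Θ N r θ} := by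
    intro Θ hΘ
    refine ⟨⌊K ^ 9 / 7 + 1⌋₊, fun N hN => ?_⟩
    obtain ⟨r, θ, h⟩ := hN
    exact Nat.le_floor (clean_run_length_le_winding hX h0 hC hK hε hεK hρ hlo hhi k hk hΘ h)
  have hne : ∀ Θ : ℝ, ({N : ℕ | ∃ r θ : ℕ → ℝ, IsCleanRun K ε ρ X Θ N r θ} : Set ℕ).Nonempty :=
    fun Θ => ⟨0, fun _ => 0, fun _ => 0, isCleanRun_zero K ε ρ X Θ⟩
  have hK9big : (68719476736 : ℝ) ≤ K ^ 9 := by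
    have := pow_le_pow_left₀ (by norm_num : (0 : ℝ) ≤ 16) hK 9; norm_num at this; exact this
  have h242 : 242 / K ^ 9 ≤ (1 : ℝ) := by rw [div_le_one hK9]; linarith only [hK9big]
  refine ⟨fun N hNW => ?_, fun Θ hΘ => ?_⟩
  · rcases Nat.eq_zero_or_pos N with hN0 | hNpos
    · rw [hN0]; exact Nat.zero_le _
    obtain ⟨r, θ, hsep, hrun⟩ :=
      knob_clean_run_pair hX h0 hC hK hε hεK hρ hlo hhi k hk hkK N hNpos hNW
    have hmem : N ∈ {N : ℕ | ∃ r θ : ℕ → ℝ, IsCleanRun K ε ρ X (29 / 20) N r θ} := by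
      refine ⟨r, θ, ?_, fun n hn => ?_, fun n hn => ?_⟩
      · obtain ⟨h, -⟩ := hrun 0 hNpos
        push_cast at h; linarith only [h]
      · linarith only [hsep n, h242]
      · obtain ⟨-, hb, hθ1, hθ2, hc, -, hP, -, -, -⟩ := hrun n hn
        exact ⟨⟨hθ1, hθ2⟩, hb, hc, hP⟩
    exact le_csSup (hbdd (29 / 20) (by norm_num)) hmem
  · obtain ⟨r, θ, h⟩ := Nat.sSup_mem (hne Θ) (hbdd Θ hΘ)
    exact clean_run_length_le_winding hX h0 hC hK hε hεK hρ hlo hhi k hk hΘ h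

/-- §321 **THE CLEAN DUD HORIZON OF EVERY LATTICE MEMBER `k ≤ K`, IN CLOSED FORM** (same setting,
winding number `k ≤ K`): `K⁹/(10·(7/2 + k²/3 + 10⁻³)) ≤ cleanHorizon K ε ρ X (29/20)` and
`cleanHorizon K ε ρ X Θ ≤ K⁹/7 + 1` for every `Θ ≤ 3/2` — the √-window of §321 at `N₀ =
⌈K⁹/(10·(7/2 + k²/3 + 10⁻³))⌉`: the linear term is `≤ 1/10`, and the log term `(14k + 127)·log
N₀/(5K⁴) ≤ (14k + 127)·9 log K/(5K⁴) ≤ 0.0269 ≤ 0.0409` (`log K ≤ (log 16/16)K` by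
`Real.log_div_self_antitoneOn`, `14k + 127 ≤ 22K`, `K² ≥ 256`). The two bounds are a factor
`5.01 + 0.48k²` apart (plus one). [derived: this file §321; `Real.log_div_self_antitoneOn`] -/
theorem knob_clean_horizon_winding_explicit
    (hX : ∀ t, HasDerivAt X (RotorKnob.rotorCircuit K (K ^ 10) ε ρ (X t)) t)
    (h0 : X 0 = delayInit) (hC : ∀ t, HasDerivAt C (X t 2) t) (hK : 16 ≤ K) (hε : 0 < ε)
    (hεK : ε ^ 2 ≤ 1 / (6 * K ^ 20)) (hρ : 0 < ρ) (hlo : 200 * ε / K ^ 20 ≤ ρ ^ 2)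
    (hhi : K ^ 10 * ρ ^ 2 ≤ 2 * ε) (k : ℕ) (hk : ε = k * K ^ 10 * ρ ^ 2) (hkK : (k : ℝ) ≤ K) :
    K ^ 9 / (10 * (7 / 2 + k ^ 2 / 3 + 1 / 1000)) ≤ (cleanHorizon K ε ρ X (29 / 20) : ℝ) ∧
      ∀ Θ : ℝ, Θ ≤ 3 / 2 → (cleanHorizon K ε ρ X Θ : ℝ) ≤ K ^ 9 / 7 + 1 := by
  have hK0 : (0 : ℝ) < K := by linarith
  have hK9 : (0 : ℝ) < K ^ 9 := by positivity
  have hk0 : (0 : ℝ) ≤ k := Nat.cast_nonneg k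
  have hK2 : (256 : ℝ) ≤ K ^ 2 := by nlinarith only [hK]
  have hkK2 : (k : ℝ) ≤ K ^ 2 := hkK.trans (by nlinarith only [hK, hK2])
  obtain ⟨hwin, hceil⟩ := knob_clean_horizon_winding hX h0 hC hK hε hεK hρ hlo hhi k hk hkK2
  refine ⟨?_, hceil⟩
  obtain ⟨c₀, hc₀_def⟩ : ∃ c₀ : ℝ, c₀ = K ^ 9 / (10 * (7 / 2 + k ^ 2 / 3 + 1 / 1000)) :=
    ⟨_, rfl⟩
  have hc₀0 : 0 < c₀ := by rw [hc₀_def]; positivity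
  obtain ⟨N₀, hN₀_def⟩ : ∃ N₀ : ℕ, N₀ = ⌈c₀⌉₊ := ⟨_, rfl⟩
  have hN₀le : c₀ ≤ (N₀ : ℝ) := by rw [hN₀_def]; exact Nat.le_ceil _
  have hN₀lt : (N₀ : ℝ) < c₀ + 1 := by rw [hN₀_def]; exact Nat.ceil_lt_add_one hc₀0.le
  have hN₀posR : (0 : ℝ) < N₀ := lt_of_lt_of_le hc₀0 hN₀le
  have hK9big : (68719476736 : ℝ) ≤ K ^ 9 := by
    have := pow_le_pow_left₀ (by norm_num : (0 : ℝ) ≤ 16) hK 9; norm_num at this; exact this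
  -- `N₀ ≤ K⁹` (as `c₀ ≤ K⁹/35`), so `log N₀ ≤ 9 log K`
  have hc₀K : c₀ ≤ K ^ 9 / 35 := by
    rw [hc₀_def]
    exact div_le_div_of_nonneg_left hK9.le (by norm_num) (by nlinarith only [sq_nonneg (k : ℝ)])
  have hN₀K : (N₀ : ℝ) ≤ K ^ 9 := by linarith only [hN₀lt, hc₀K, hK9big]
  have hlogN : log (N₀ : ℝ) ≤ 9 * log K := by
    have h := Real.log_le_log hN₀posR hN₀K
    have h9 : log (K ^ 9) = 9 * log K := by rw [Real.log_pow]; norm_num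
    linarith only [h, h9]
  -- `log K ≤ (log 16/16)·K` (`Real.log_div_self_antitoneOn`, as part 118 §314)
  have he16 : exp 1 ≤ 16 := by have := Real.exp_one_lt_d9; linarith
  have hmono := Real.log_div_self_antitoneOn (show (16 : ℝ) ∈ Set.Ici (exp 1) from he16)
    (show K ∈ Set.Ici (exp 1) from le_trans he16 hK) hK
  simp only at hmono
  have hlog16 : log 16 ≤ 2773 / 1000 := by
    have e : log (16 : ℝ) = 4 * log 2 := by
      rw [show (16 : ℝ) = 2 ^ 4 by norm_num, Real.log_pow]; norm_num
    rw [e]; linarith only [Real.log_two_lt_d9]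
  have hl : log K ≤ 2773 / 16000 * K := by
    rw [div_le_iff₀ hK0] at hmono
    have := mul_le_mul_of_nonneg_right (div_le_div_of_nonneg_right hlog16 (by norm_num :
      (0 : ℝ) ≤ 16)) hK0.le
    linarith only [hmono, this]
  -- the log term of the window: `(14k + 127)·9 log K/(5K⁴) ≤ 0.0409`
  have hlogt : (14 * k + 127) / (5 * K ^ 4) * (9 * log K) ≤ 409 / 10000 := by
    rw [div_mul_eq_mul_div, div_le_iff₀ (by positivity)]
    have h22 : (14 * k + 127 : ℝ) ≤ 22 * K := by linarith only [hkK, hK]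
    have hlogK : 0 ≤ log K := Real.log_nonneg (by linarith only [hK])
    have hK4 : 256 * K ^ 2 ≤ K ^ 4 := by nlinarith only [hK2]
    calc (14 * k + 127) * (9 * log K) ≤ 22 * K * (9 * (2773 / 16000 * K)) :=
          mul_le_mul h22 (by linarith only [hl]) (by positivity) (by positivity)
      _ = 549054 / 16000 * K ^ 2 := by ring
      _ ≤ 409 / 10000 * (5 * K ^ 4) := by linarith only [hK4, hK2]
  -- the √-window at `N₀`
  have hwin₀ : ((N₀ : ℝ) - 1) * ((7 / 2 + k ^ 2 / 3 + 1 / 1000) / K ^ 9)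
      + (14 * k + 127) / (5 * K ^ 4) * log N₀ ≤ 1409 / 10000 := by
    have hcM0 : (0 : ℝ) ≤ (14 * k + 127) / (5 * K ^ 4) := by positivity
    have h1 : ((N₀ : ℝ) - 1) * ((7 / 2 + k ^ 2 / 3 + 1 / 1000) / K ^ 9) ≤ 1 / 10 := by
      have h := mul_le_mul_of_nonneg_right
        (le_of_lt (by linarith only [hN₀lt] : (N₀ : ℝ) - 1 < c₀))
        (by positivity : (0 : ℝ) ≤ (7 / 2 + k ^ 2 / 3 + 1 / 1000) / K ^ 9)
      have e : c₀ * ((7 / 2 + k ^ 2 / 3 + 1 / 1000) / K ^ 9) = 1 / 10 := by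
        rw [hc₀_def, div_mul_div_comm, div_eq_div_iff (by positivity) (by norm_num)]
        ring
      linarith only [h, e]
    have h2 := mul_le_mul_of_nonneg_left hlogN hcM0
    linarith only [h1, h2, hlogt]
  have hle : N₀ ≤ cleanHorizon K ε ρ X (29 / 20) := hwin N₀ hwin₀
  calc K ^ 9 / (10 * (7 / 2 + k ^ 2 / 3 + 1 / 1000)) = c₀ := hc₀_def.symm
    _ ≤ (N₀ : ℝ) := hN₀le
    _ ≤ (cleanHorizon K ε ρ X (29 / 20) : ℝ) := by exact_mod_cast hle

end Summit.NavierStokesRegularity.FluidComputer.GateBudget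

end
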